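import Mathlib
import Summits.AtomisticToContinuum.HydrodynamicLimit.Theorems.OneSphereInfluenceStaticScoreResponseKPSmallness
import Summits.AtomisticToContinuum.HydrodynamicLimit.Theorems.JaynesSqueezeLocalGibbsConcentrationDiluteTilt
import Literature.MathematicalPhysics.KineticTheory.HardSphereEulerLLN
import HarnessLib
import Summits.AtomisticToContinuum.HydrodynamicLimit.Theorems.OneSphereInfluenceStaticScoreResponseLogPartitionDeriv
import Literature.Analysis.Complex.CauchyTaylorBall

/-!
# `StaticScoreResponse` (support item stmt-AtomisticToContinuum-12269): the holomorphic extension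
# of the tilted canonical log-partition function of hard spheres on `𝕋³`

For a continuous positive activity `b` on `𝕋³`, a continuous one-body observable `|G| ≤ 1`, a
diameter `0 ≤ ε < 1/2` and `n` particles, consider the configurational canonical partition functions
of the exponentially tilted activities `b e^{sG}` (`posPartition`, `HardSphereEulerProofs`):

`φ(s) = n⁻¹ log Z_n(b e^{sG})`, `Z_n(a) = ∫_{(𝕋³)ⁿ} 𝟙_{no overlap} ∏ᵢ a(xᵢ) dx`.

Under the low-density smallness condition `2A²e⁴ · n · p_ε ≤ 1` (`p_ε = M v₁ ε³` the overlap
scale of the normalised profile `β = b/∫b`, `A = 2e^{1/4}`), `exists_analytic_logPartition`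
produces `Φ` HOLOMORPHIC on the complex disc `‖s‖ < 1/4`, bounded by `3` there, with

`φ(s) = log ∫b + Re Φ(s)` for real `|s| < 1/4`

— namely `Φ(s) = log m(s) + n⁻¹ h(s)` with `m(s) = ∫ e^{sG} dβ` and `h` the Kotecký–Preiss
logarithm of the tilted hard-core probability (`exists_log_hcProb_tilted`), using
`Z_n(b e^{sG}) = (∫ b e^{sG})ⁿ · Ξ_s` (`posPartition_eq`) and the identification of the normalised
tilted profile with the tilted one-particle law (`profileOf_tilt_μ`). Cauchy estimates on `Φ`
then bound all `s`-derivatives of `φ`, i.e. the cumulants of `∑ᵢ G(xᵢ)` under the canonical Gibbs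
measure, uniformly in `n` (next file). Folklore; no definitions, no named facts.
-/

noncomputable section

namespace Summit.AtomisticToContinuum.HydrodynamicLimit.Theorems

open Finset MeasureTheory Complex Metric Literature.Probability.LatticeModels
  Literature.MathematicalPhysics.StatisticalMechanics Literature.MathematicalPhysics.KineticTheory

variable {b G : T3 → ℝ}

/-! ### The tilted profile and its one-particle law -/

/-- The mean tilting factor under the normalised profile: `∫ e^{sG} dβ = (∫ b e^{sG}) / ∫ b`.
[folklore] -/
theorem integral_exp_mul_profileOf (hb : Continuous b) (hb0 : ∀ x, 0 < b x) (s : ℝ) :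
    ∫ y, Real.exp (s * G y) ∂(profileOf b hb hb0).μ = (∫ y, b y * Real.exp (s * G y)) / ∫ y, b y := by
  rw [DensityProfile.integral_μ]
  simp only [profileOf_β]
  rw [← integral_div]
  refine integral_congr_ae (ae_of_all _ fun y => ?_)
  ring

/-- **The normalised tilted profile is the tilted one-particle law**:
`(b e^{sG} / ∫ b e^{sG}) dy = (e^{sG}/m(s)) · β(y) dy` with `β = b/∫b`, `m(s) = ∫ e^{sG} dβ`.
[folklore] -/
theorem profileOf_tilt_μ (hb : Continuous b) (hb0 : ∀ x, 0 < b x) (hG : Continuous G) (s : ℝ)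
    (hbs : Continuous fun x => b x * Real.exp (s * G x)) (hbs0 : ∀ x, 0 < b x * Real.exp (s * G x)) :
    (profileOf (fun x => b x * Real.exp (s * G x)) hbs hbs0).μ =
      (profileOf b hb hb0).μ.withDensity fun y => ENNReal.ofReal
        (Real.exp (s * G y) / ∫ y', Real.exp (s * G y') ∂(profileOf b hb hb0).μ) := by
  have hB : 0 < ∫ y, b y := integral_pos_of_continuous_pos hb hb0
  have hE : 0 < ∫ y, b y * Real.exp (s * G y) := integral_pos_of_continuous_pos hbs hbs0
  rw [integral_exp_mul_profileOf hb hb0 s]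
  unfold DensityProfile.μ
  have hf : Measurable fun y => ENNReal.ofReal ((profileOf b hb hb0).β y) :=
    ENNReal.measurable_ofReal.comp (profileOf b hb hb0).continuous.measurable
  have hg : Measurable fun y => ENNReal.ofReal
      (Real.exp (s * G y) / ((∫ y, b y * Real.exp (s * G y)) / ∫ y, b y)) :=
    ENNReal.measurable_ofReal.comp ((Real.measurable_exp.comp (measurable_const.mul hG.measurable)).div_const _)
  rw [← withDensity_mul _ hf hg]
  congr 1
  funext y
  simp only [Pi.mul_apply, profileOf_β]
  rw [← ENNReal.ofReal_mul (div_nonneg (hb0 y).le hB.le)]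
  congr 1
  field_simp

/-! ### The holomorphic extension -/

/-- **Holomorphic extension of the tilted canonical log-partition function.** For a continuous
positive activity `b`, a continuous observable `|G| ≤ 1`, `0 ≤ ε < 1/2` and `n ≥ 1` particles with
`2A²e⁴ n p_ε ≤ 1`: there is `Φ` holomorphic on `‖s‖ < 1/4` with `‖Φ‖ ≤ 3` there, such that for real
`|s| < 1/4` the partition function `Z_n(b e^{sG})` is positive and
`n⁻¹ log Z_n(b e^{sG}) = log ∫b + Re Φ(s)`. [folklore] -/
theorem exists_analytic_logPartition (hb : Continuous b) (hb0 : ∀ x, 0 < b x) (hGc : Continuous G)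
    (hG1 : ∀ x, |G x| ≤ 1) {ε : ℝ} (hε : 0 ≤ ε) (hε2 : ε < 1 / 2) {n : ℕ} (hn : 0 < n)
    (hsmall : 2 * (2 * Real.exp (1 / 4)) ^ 2 * Real.exp 1 ^ 4 * (n * pOv (profileOf b hb hb0) ε) ≤ 1) :
    ∃ Φ : ℂ → ℂ, DifferentiableOn ℂ Φ (ball 0 (1 / 4)) ∧ (∀ s ∈ ball (0 : ℂ) (1 / 4), ‖Φ s‖ ≤ 3) ∧
      ∀ s : ℝ, |s| < 1 / 4 →
        0 < posPartition (fun x => b x * Real.exp (s * G x)) ε n ∧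
        (n : ℝ)⁻¹ * Real.log (posPartition (fun x => b x * Real.exp (s * G x)) ε n) =
          Real.log (∫ x, b x) + (Φ s).re := by
  set P := profileOf b hb hb0 with hP
  set ν := P.μ with hν
  have hB : 0 < ∫ y, b y := integral_pos_of_continuous_pos hb hb0
  have hO : MeasurableSet {p : T3 × T3 | Ov ε p.1 p.2} := measurableSet_ov ε
  have hGm : Measurable G := hGc.measurable
  have hp0 : 0 ≤ pOv P ε := pOv_nonneg P hε
  have hp : ∀ z, ν {y | Ov ε z y} ≤ ENNReal.ofReal (pOv P ε) := fun z => μ_ov_le_pOv P hε hε2 z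
  have hsmall' : 2 * (2 * Real.exp (1 / 4)) ^ 2 * Real.exp 1 ^ 4 * (Fintype.card (Fin n) * pOv P ε) ≤ 1 := by
    rwa [Fintype.card_fin]
  obtain ⟨h, hh, hbd, hreal⟩ := exists_log_hcProb_tilted (ι := Fin n) ν hO (ov_symm ε) hGm hG1 hp0 hp hsmall'
  -- the mean tilting factor and the extension
  set m : ℂ → ℂ := fun s => ∫ y, Complex.exp (s * (G y : ℂ)) ∂ν with hm
  have hmd : DifferentiableOn ℂ m (ball 0 (1 / 4)) :=
    (differentiableOn_integral_cexp ν hGm hG1).mono (ball_subset_ball (by norm_num))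
  have hm1 : ∀ s ∈ ball (0 : ℂ) (1 / 4), ‖m s - 1‖ ≤ 1 / 2 := fun s hs => by
    have hs' : ‖s‖ ≤ 1 / 4 := le_of_lt (by simpa using hs)
    have := norm_integral_cexp_sub_one_le ν hGm hG1 (hs'.trans (by norm_num))
    linarith
  refine ⟨fun s => Complex.log (m s) + (n : ℂ)⁻¹ * h s, ?_, ?_, ?_⟩
  · -- holomorphy
    refine (hmd.clog fun s hs => Or.inl (re_pos_of_norm_sub_one_lt ((hm1 s hs).trans_lt (by norm_num)))).add
      (hh.const_mul _)
  · -- the bound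
    intro s hs
    have h1 : ‖Complex.log (m s)‖ ≤ 3 / 4 := by
      have := Complex.norm_log_one_add_half_le_self (hm1 s hs)
      rw [add_sub_cancel] at this
      linarith [hm1 s hs]
    have h2 : ‖(n : ℂ)⁻¹ * h s‖ ≤ 2 := by
      rw [norm_mul, norm_inv, Complex.norm_natCast]
      have hn' : (0 : ℝ) < n := by exact_mod_cast hn
      calc (n : ℝ)⁻¹ * ‖h s‖ ≤ (n : ℝ)⁻¹ * (2 * Fintype.card (Fin n)) :=
            mul_le_mul_of_nonneg_left (hbd s hs) (by positivity)
        _ = 2 := by rw [Fintype.card_fin]; field_simp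
    calc ‖Complex.log (m s) + (n : ℂ)⁻¹ * h s‖ ≤ ‖Complex.log (m s)‖ + ‖(n : ℂ)⁻¹ * h s‖ := norm_add_le _ _
      _ ≤ 3 / 4 + 2 := add_le_add h1 h2
      _ ≤ 3 := by norm_num
  · -- real parameters
    intro s hs
    have hbs : Continuous fun x => b x * Real.exp (s * G x) := LocalGibbsConcentration.continuous_tilt hb hGc s
    have hbs0 : ∀ x, 0 < b x * Real.exp (s * G x) := LocalGibbsConcentration.tilt_pos hb0 G s
    have hE : 0 < ∫ y, b y * Real.exp (s * G y) := integral_pos_of_continuous_pos hbs hbs0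
    obtain ⟨hpos, hhs⟩ := hreal s hs
    -- the hard-core probability of the tilted gas is `Ξ` of the normalised tilted profile
    have hXi : Xi (profileOf (fun x => b x * Real.exp (s * G x)) hbs hbs0) ε n n =
        hcProb (Ov ε) (ν.withDensity fun y => ENNReal.ofReal
          (Real.exp (s * G y) / ∫ y', Real.exp (s * G y') ∂ν)) (univ : Finset (Fin n)) := by
      rw [Xi, firstLabels_self, profileOf_tilt_μ hb hb0 hGc s hbs hbs0]
    have hZeq := posPartition_eq hbs hbs0 ε n
    rw [hXi] at hZeq
    -- the real mean tilting factor
    have hmr : 0 < ∫ y, Real.exp (s * G y) ∂ν := integral_exp_mul_pos ν hGm hG1 s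
    have hms : m (s : ℂ) = ((∫ y, Real.exp (s * G y) ∂ν : ℝ) : ℂ) := by
      rw [hm]
      simp only
      rw [← integral_complex_ofReal]
      refine integral_congr_ae (ae_of_all _ fun y => ?_)
      push_cast
      rfl
    have hEeq : (∫ y, b y * Real.exp (s * G y)) = (∫ y, b y) * ∫ y, Real.exp (s * G y) ∂ν := by
      rw [hν, hP, integral_exp_mul_profileOf hb hb0 s]
      field_simp
    refine ⟨?_, ?_⟩
    · rw [hZeq]
      exact mul_pos (pow_pos hE n) hpos
    · rw [hZeq, Real.log_mul (pow_pos hE n).ne' hpos.ne', Real.log_pow, hEeq,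
        Real.log_mul hB.ne' hmr.ne']
      simp only [Complex.add_re, Complex.mul_re, Complex.inv_re, Complex.natCast_re, Complex.normSq_natCast,
        Complex.natCast_im, Complex.inv_im, hhs, Complex.ofReal_re, Complex.ofReal_im, hms,
        Complex.log_ofReal_re]
      have hn' : (n : ℝ) ≠ 0 := by exact_mod_cast hn.ne'
      field_simp
      ring

end Summit.AtomisticToContinuum.HydrodynamicLimit.Theorems

end

/-!
# `StaticScoreResponse` (support item stmt-AtomisticToContinuum-12269): derivatives of the
# holomorphic extension are tilted canonical means and variances

With `Φ` the holomorphic extension of the tilted canonical log-partition function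
`φ(s) = n⁻¹ log Z_n(b e^{sG})` (`exists_analytic_logPartition`) and the finite-`n` score identity
(`hasDerivAt_integral_posGibbsMeasure`), the real derivatives of `φ = log ∫b + Re Φ` along the real
axis are the tilted canonical means and variances of the extensive observable `S_G = ∑ᵢ G(xᵢ)`:

* `hasDerivAt_tilted_posPartition`, `hasDerivAt_tilted_mean` — the score identity for the
  exponential tilt family `b e^{sG}` (score `S_G`);
* `exists_analytic_logPartition_deriv` — `Re Φ'(s) = E_s[n⁻¹ S_G]` and
  `Re Φ''(s) = E_s[n⁻¹ S_G · S_G] - E_s[n⁻¹ S_G] E_s[S_G] = n⁻¹ Var_s(S_G)` for real `|s| < 1/4`,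
  where `E_s` is the expectation under `posGibbsMeasure (b e^{sG}) ε n`, together with `‖Φ‖ ≤ 3` on
  the disc `‖s‖ < 1/4`.

Cauchy's estimates for `Φ` then bound these uniformly in `n` (next file). Folklore; no definitions,
no named facts.
-/

noncomputable section

namespace Summit.AtomisticToContinuum.HydrodynamicLimit.Theorems

open Finset MeasureTheory Complex Metric Set Filter Topology
  Literature.MathematicalPhysics.StatisticalMechanics Literature.MathematicalPhysics.KineticTheory

variable {b G : T3 → ℝ}

/-! ### The tilt family and the hypotheses of the score identity -/

/-- At `s = 0` the tilted activity is `b`. [folklore] -/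
theorem tilt_zero (b G : T3 → ℝ) : (fun x => b x * Real.exp (0 * G x)) = b := by
  funext x; simp

/-- The configurational Gibbs measure of an activity with positive partition function is a
probability measure. [folklore] -/
theorem isProbabilityMeasure_posGibbsMeasure_of_pos {a : T3 → ℝ} (ha : Continuous a) (ha0 : ∀ x, 0 ≤ a x)
    {ε : ℝ} {n : ℕ} (hZ : 0 < posPartition a ε n) : IsProbabilityMeasure (posGibbsMeasure a ε n) := by
  refine ⟨?_⟩
  rw [posGibbsMeasure, withDensity_apply _ MeasurableSet.univ, Measure.restrict_univ]
  simp_rw [ENNReal.ofReal_mul (inv_nonneg.2 hZ.le)]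
  rw [lintegral_const_mul' _ _ ENNReal.ofReal_ne_top, ← ofReal_posPartition ha ha0,
    ← ENNReal.ofReal_mul (inv_nonneg.2 hZ.le), inv_mul_cancel₀ hZ.ne', ENNReal.ofReal_one]

/-- The score of the exponential tilt family `b e^{sG}` is `∑ᵢ G(xᵢ)`. [folklore] -/
theorem tilt_score (hb0 : ∀ x, 0 < b x) (s : ℝ) {n : ℕ} (x : Fin n → T3) :
    ∑ i, G (x i) * (b (x i) * Real.exp (s * G (x i))) / (b (x i) * Real.exp (s * G (x i))) = ∑ i, G (x i) :=
  Finset.sum_congr rfl fun i _ => by rw [mul_div_assoc, div_self (LocalGibbsConcentration.tilt_pos hb0 G s (x i)).ne', mul_one]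

/-- Size of the tilting factor for parameters in the working range: `e^{tG(y)} ≤ e` for
`|t - s| < 1/4`, `|s| < 1/4`, `|G| ≤ 1`. [folklore] -/
theorem exp_tilt_le (hG1 : ∀ x, |G x| ≤ 1) {s t : ℝ} (hs : |s| < 1 / 4) (ht : t ∈ ball s (1 / 4)) (y : T3) :
    Real.exp (t * G y) ≤ Real.exp 1 := by
  refine Real.exp_le_exp.2 ?_
  have ht' : |t| < 1 := by
    have : |t - s| < 1 / 4 := by simpa [Real.dist_eq] using ht
    have := abs_sub_abs_le_abs_sub t s
    linarith [abs_nonneg s]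
  calc t * G y ≤ |t * G y| := le_abs_self _
    _ = |t| * |G y| := abs_mul _ _
    _ ≤ 1 * 1 := mul_le_mul ht'.le (hG1 y) (abs_nonneg _) zero_le_one
    _ = 1 := one_mul _

/-- The derivative of the tilt family in the parameter. [folklore] -/
theorem hasDerivAt_tilt (b G : T3 → ℝ) (t : ℝ) (y : T3) :
    HasDerivAt (fun t : ℝ => b y * Real.exp (t * G y)) (G y * (b y * Real.exp (t * G y))) t := by
  have h1 : HasDerivAt (fun t : ℝ => t * G y) (G y) t := by simpa using (hasDerivAt_id t).mul_const (G y)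
  exact ((h1.exp).const_mul (b y)).congr_deriv (by ring)

/-- **Derivative of weighted canonical integrals along the tilt family**:
`d/dt|_s ∫ F posWeight(b e^{tG}) = ∫ F · S_G · posWeight(b e^{sG})` for bounded measurable `F`,
`|s| < 1/4`. [folklore] -/
theorem hasDerivAt_tilted_weight (hb : Continuous b) (hb0 : ∀ x, 0 < b x) (hGc : Continuous G)
    (hG1 : ∀ x, |G x| ≤ 1) (ε : ℝ) {n : ℕ} {s : ℝ} (hs : |s| < 1 / 4)
    {F : (Fin n → T3) → ℝ} (hFm : Measurable F) {K : ℝ} (hFK : ∀ x, |F x| ≤ K) :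
    HasDerivAt (fun t => ∫ x, F x * posWeight (fun x => b x * Real.exp (t * G x)) ε n x)
      (∫ x, F x * (∑ i, G (x i)) * posWeight (fun x => b x * Real.exp (s * G x)) ε n x) s := by
  obtain ⟨B, hB0, hB⟩ := exists_forall_abs_le_of_continuous hb
  have h := hasDerivAt_integral_mul_posWeight' (n := n) (a := fun t x => b x * Real.exp (t * G x))
    (a' := fun t x => G x * (b x * Real.exp (t * G x))) (κ₀ := s) (r := 1 / 4) (C := B * Real.exp 1)
    (by norm_num) (by positivity)
    (fun t _ => LocalGibbsConcentration.continuous_tilt hb hGc t) (fun t _ => hGc.mul (LocalGibbsConcentration.continuous_tilt hb hGc t))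
    (fun t _ y => hasDerivAt_tilt b G t y)
    (fun t ht y => by
      rw [abs_mul, abs_of_pos (Real.exp_pos _)]
      exact mul_le_mul (hB y) (exp_tilt_le hG1 hs ht y) (Real.exp_nonneg _) hB0)
    (fun t ht y => by
      rw [abs_mul, abs_mul, abs_of_pos (Real.exp_pos _)]
      calc |G y| * (|b y| * Real.exp (t * G y)) ≤ 1 * (B * Real.exp 1) :=
            mul_le_mul (hG1 y) (mul_le_mul (hB y) (exp_tilt_le hG1 hs ht y) (Real.exp_nonneg _) hB0)
              (by positivity) zero_le_one
        _ = B * Real.exp 1 := one_mul _)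
    (fun y => LocalGibbsConcentration.tilt_pos hb0 G s y) hFm hFK ε
  simp only [tilt_score hb0] at h
  exact h

/-- **Derivative of the tilted partition function**: `d/dt|_s Z_n(b e^{tG}) = ∫ S_G posWeight(b e^{sG})`.
[folklore] -/
theorem hasDerivAt_tilted_posPartition (hb : Continuous b) (hb0 : ∀ x, 0 < b x) (hGc : Continuous G)
    (hG1 : ∀ x, |G x| ≤ 1) (ε : ℝ) (n : ℕ) {s : ℝ} (hs : |s| < 1 / 4) :
    HasDerivAt (fun t => posPartition (fun x => b x * Real.exp (t * G x)) ε n)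
      (∫ x, (∑ i, G (x i)) * posWeight (fun x => b x * Real.exp (s * G x)) ε n x) s := by
  have h := hasDerivAt_tilted_weight hb hb0 hGc hG1 ε (n := n) hs (F := fun _ => (1 : ℝ))
    measurable_const (K := 1) (fun _ => by simp)
  simp only [one_mul] at h
  exact h

/-- **The score identity for the tilt family.** For continuous positive `b`, continuous `|G| ≤ 1`,
`|s| < 1/4` with `Z_n(b e^{sG}) > 0`, and bounded measurable `F`:
`d/dt|_s E_t[F] = E_s[F S_G] - E_s[F] E_s[S_G]`, `S_G = ∑ᵢ G(xᵢ)`. [folklore] -/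
theorem hasDerivAt_tilted_mean (hb : Continuous b) (hb0 : ∀ x, 0 < b x) (hGc : Continuous G)
    (hG1 : ∀ x, |G x| ≤ 1) {ε : ℝ} {n : ℕ} {s : ℝ} (hs : |s| < 1 / 4)
    (hZ : 0 < posPartition (fun x => b x * Real.exp (s * G x)) ε n)
    {F : (Fin n → T3) → ℝ} (hFm : Measurable F) {K : ℝ} (hFK : ∀ x, |F x| ≤ K) :
    HasDerivAt (fun t => ∫ x, F x ∂posGibbsMeasure (fun x => b x * Real.exp (t * G x)) ε n)
      ((∫ x, F x * ∑ i, G (x i) ∂posGibbsMeasure (fun x => b x * Real.exp (s * G x)) ε n) -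
        (∫ x, F x ∂posGibbsMeasure (fun x => b x * Real.exp (s * G x)) ε n) *
          ∫ x, ∑ i, G (x i) ∂posGibbsMeasure (fun x => b x * Real.exp (s * G x)) ε n) s := by
  obtain ⟨B, hB0, hB⟩ := exists_forall_abs_le_of_continuous hb
  have h := hasDerivAt_integral_posGibbsMeasure (n := n) (a := fun t x => b x * Real.exp (t * G x))
    (a' := fun t x => G x * (b x * Real.exp (t * G x))) (κ₀ := s) (r := 1 / 4) (C := B * Real.exp 1)
    (by norm_num) (by positivity)
    (fun t _ => LocalGibbsConcentration.continuous_tilt hb hGc t) (fun t _ => hGc.mul (LocalGibbsConcentration.continuous_tilt hb hGc t))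
    (fun t _ y => hasDerivAt_tilt b G t y)
    (fun t ht y => by
      rw [abs_mul, abs_of_pos (Real.exp_pos _)]
      exact mul_le_mul (hB y) (exp_tilt_le hG1 hs ht y) (Real.exp_nonneg _) hB0)
    (fun t ht y => by
      rw [abs_mul, abs_mul, abs_of_pos (Real.exp_pos _)]
      calc |G y| * (|b y| * Real.exp (t * G y)) ≤ 1 * (B * Real.exp 1) :=
            mul_le_mul (hG1 y) (mul_le_mul (hB y) (exp_tilt_le hG1 hs ht y) (Real.exp_nonneg _) hB0)
              (by positivity) zero_le_one
        _ = B * Real.exp 1 := one_mul _)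
    (fun t _ y => (LocalGibbsConcentration.tilt_pos hb0 G t y).le) (fun y => LocalGibbsConcentration.tilt_pos hb0 G s y) hZ hFm hFK
  simp only [tilt_score hb0] at h
  exact h

/-! ### Identification of the derivatives of the holomorphic extension -/

/-- The normalised extensive observable `n⁻¹ S_G` is measurable. [folklore] -/
theorem measurable_avg_sum (hGc : Continuous G) (n : ℕ) :
    Measurable fun x : Fin n → T3 => (n : ℝ)⁻¹ * ∑ i, G (x i) :=
  (Finset.measurable_sum _ fun i _ => hGc.measurable.comp (measurable_pi_apply i)).const_mul _

/-- `|n⁻¹ S_G| ≤ 1` for `|G| ≤ 1`. [folklore] -/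
theorem abs_avg_sum_le (hG1 : ∀ x, |G x| ≤ 1) {n : ℕ} (x : Fin n → T3) :
    |(n : ℝ)⁻¹ * ∑ i, G (x i)| ≤ 1 := by
  rcases Nat.eq_zero_or_pos n with hn | hn
  · subst hn; simp
  have hn' : (0 : ℝ) < n := by exact_mod_cast hn
  rw [abs_mul, abs_of_pos (inv_pos.2 hn')]
  calc (n : ℝ)⁻¹ * |∑ i, G (x i)| ≤ (n : ℝ)⁻¹ * n := by
        refine mul_le_mul_of_nonneg_left ?_ (by positivity)
        calc |∑ i, G (x i)| ≤ ∑ i, |G (x i)| := Finset.abs_sum_le_sum_abs _ _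
          _ ≤ ∑ _i : Fin n, (1 : ℝ) := Finset.sum_le_sum fun i _ => hG1 _
          _ = n := by simp
    _ = 1 := by field_simp

/-- Real parameters in the working range form a neighbourhood. [folklore] -/
theorem eventually_abs_lt {s : ℝ} (hs : |s| < 1 / 4) : ∀ᶠ t in 𝓝 s, |t| < 1 / 4 :=
  continuous_abs.continuousAt.preimage_mem_nhds (Iio_mem_nhds hs)

/-- **`Re Φ'` is the tilted mean and `Re Φ''` is `n⁻¹ ×` the tilted variance.** The package
extracted from `exists_analytic_logPartition` and the score identity: `Φ` holomorphic on
`‖s‖ < 1/4` with `‖Φ‖ ≤ 3`, and for real `|s| < 1/4`: `Z_n(b e^{sG}) > 0`,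
`Re Φ'(s) = E_s[n⁻¹ S_G]`, `Re Φ''(s) = E_s[n⁻¹ S_G S_G] - E_s[n⁻¹ S_G] E_s[S_G]`. [folklore] -/
theorem exists_analytic_logPartition_deriv (hb : Continuous b) (hb0 : ∀ x, 0 < b x) (hGc : Continuous G)
    (hG1 : ∀ x, |G x| ≤ 1) {ε : ℝ} (hε : 0 ≤ ε) (hε2 : ε < 1 / 2) {n : ℕ} (hn : 0 < n)
    (hsmall : 2 * (2 * Real.exp (1 / 4)) ^ 2 * Real.exp 1 ^ 4 * (n * pOv (profileOf b hb hb0) ε) ≤ 1) :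
    ∃ Φ : ℂ → ℂ, DifferentiableOn ℂ Φ (ball 0 (1 / 4)) ∧ (∀ s ∈ ball (0 : ℂ) (1 / 4), ‖Φ s‖ ≤ 3) ∧
      ∀ s : ℝ, |s| < 1 / 4 →
        0 < posPartition (fun x => b x * Real.exp (s * G x)) ε n ∧
        (deriv Φ s).re = ∫ x, (n : ℝ)⁻¹ * ∑ i, G (x i) ∂posGibbsMeasure (fun x => b x * Real.exp (s * G x)) ε n ∧
        (deriv (deriv Φ) s).re =
          (∫ x, ((n : ℝ)⁻¹ * ∑ i, G (x i)) * ∑ i, G (x i) ∂posGibbsMeasure (fun x => b x * Real.exp (s * G x)) ε n) -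
            (∫ x, (n : ℝ)⁻¹ * ∑ i, G (x i) ∂posGibbsMeasure (fun x => b x * Real.exp (s * G x)) ε n) *
              ∫ x, ∑ i, G (x i) ∂posGibbsMeasure (fun x => b x * Real.exp (s * G x)) ε n := by
  obtain ⟨Φ, hΦ, hΦ3, hreal⟩ := exists_analytic_logPartition hb hb0 hGc hG1 hε hε2 hn hsmall
  refine ⟨Φ, hΦ, hΦ3, fun s₀ hs₀ => ?_⟩
  have hopen : IsOpen (ball (0 : ℂ) (1 / 4)) := isOpen_ball
  have hΦ'd : DifferentiableOn ℂ (deriv Φ) (ball 0 (1 / 4)) := (hΦ.analyticOnNhd hopen).deriv.differentiableOn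
  have hmemC : ∀ s : ℝ, |s| < 1 / 4 → ((s : ℝ) : ℂ) ∈ ball (0 : ℂ) (1 / 4) := fun s hs => by simpa using hs
  -- real derivatives of `Re Φ` and `Re Φ'` along the real axis
  have hre1 : ∀ s : ℝ, |s| < 1 / 4 → HasDerivAt (fun t : ℝ => (Φ t).re) (deriv Φ s).re s := fun s hs =>
    ((hΦ.differentiableAt (hopen.mem_nhds (hmemC s hs))).hasDerivAt).real_of_complex
  have hre2 : ∀ s : ℝ, |s| < 1 / 4 → HasDerivAt (fun t : ℝ => (deriv Φ t).re) (deriv (deriv Φ) s).re s :=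
    fun s hs => ((hΦ'd.differentiableAt (hopen.mem_nhds (hmemC s hs))).hasDerivAt).real_of_complex
  -- Step 1: `Re Φ'(s) = E_s[n⁻¹ S]` for all `|s| < 1/4`
  have hstep1 : ∀ s : ℝ, |s| < 1 / 4 →
      (deriv Φ s).re = ∫ x, (n : ℝ)⁻¹ * ∑ i, G (x i) ∂posGibbsMeasure (fun x => b x * Real.exp (s * G x)) ε n := by
    intro s hs
    obtain ⟨hZs, -⟩ := hreal s hs
    -- `t ↦ n⁻¹ log Z(t)` has derivative `n⁻¹ Z'(s)/Z(s) = E_s[n⁻¹ S]`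
    have hlogZ : HasDerivAt (fun t : ℝ => (n : ℝ)⁻¹ * Real.log (posPartition (fun x => b x * Real.exp (t * G x)) ε n))
        (∫ x, (n : ℝ)⁻¹ * ∑ i, G (x i) ∂posGibbsMeasure (fun x => b x * Real.exp (s * G x)) ε n) s := by
      have hl := ((hasDerivAt_tilted_posPartition hb hb0 hGc hG1 ε n hs).log hZs.ne').const_mul ((n : ℝ)⁻¹)
      refine hl.congr_deriv ?_
      rw [integral_posGibbsMeasure_eq (LocalGibbsConcentration.continuous_tilt hb hGc s) (fun y => (LocalGibbsConcentration.tilt_pos hb0 G s y).le) ε n]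
      rw [div_eq_inv_mul, ← mul_assoc, mul_comm ((n : ℝ)⁻¹), mul_assoc, ← integral_const_mul]
      congr 1
      refine integral_congr_ae (ae_of_all _ fun x => ?_)
      ring
    -- `n⁻¹ log Z(t) = log ∫b + Re Φ(t)` near `s`
    have hev : ∀ᶠ t : ℝ in 𝓝 s, Real.log (∫ x, b x) + (Φ (t : ℂ)).re =
        (n : ℝ)⁻¹ * Real.log (posPartition (fun x => b x * Real.exp (t * G x)) ε n) := by
      filter_upwards [eventually_abs_lt hs] with t ht
      exact ((hreal t ht).2).symm
    have hre_s : HasDerivAt (fun t : ℝ => (Φ t).re)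
        (∫ x, (n : ℝ)⁻¹ * ∑ i, G (x i) ∂posGibbsMeasure (fun x => b x * Real.exp (s * G x)) ε n) s := by
      have h2 := hlogZ.congr_of_eventuallyEq hev
      simpa using h2.const_add (-Real.log (∫ x, b x))
    exact (hre1 s hs).unique hre_s
  obtain ⟨hZ, -⟩ := hreal s₀ hs₀
  refine ⟨hZ, hstep1 s₀ hs₀, ?_⟩
  -- Step 2: `Re Φ''(s₀) = Cov_{s₀}(n⁻¹S, S)`
  have hmean := hasDerivAt_tilted_mean hb hb0 hGc hG1 (ε := ε) (n := n) hs₀ hZ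
    (measurable_avg_sum hGc n) (abs_avg_sum_le hG1)
  have hev : ∀ᶠ t : ℝ in 𝓝 s₀, (deriv Φ (t : ℂ)).re =
      ∫ x, (n : ℝ)⁻¹ * ∑ i, G (x i) ∂posGibbsMeasure (fun x => b x * Real.exp (t * G x)) ε n := by
    filter_upwards [eventually_abs_lt hs₀] with t ht
    exact hstep1 t ht
  exact (hre2 s₀ hs₀).unique (hmean.congr_of_eventuallyEq hev)

end Summit.AtomisticToContinuum.HydrodynamicLimit.Theorems

end
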